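import Mathlib
import Summits.MatrixMultiplication.MatrixMultiplication.Theses.FourierTwoFamiliesModP

/-!
# Sketch (crux-ideate round 2, ideator 4) — crux `PrimeTwoFamilies` (stmt-MatrixMultiplication-14308)

Idea card `spherical-biclique-certificate`: the SPHERICAL CERTIFICATE for the two-families clause (X).

If all `A`-points lie on one integer sphere `a ⬝ᵥ a = ρ`, all `B`-points on one sphere `b ⬝ᵥ b = σ`, and the
level-`τ` "orthogonality" bigraph `{(a,b) : a ⬝ᵥ b = τ}` restricted to `(⊔ Aᵢ) × (⊔ Bᵢ)` is EXACTLY the disjoint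
union of the bicliques `Aᵢ × Bᵢ` (inside a block every pair has `a ⬝ᵥ b = τ`; across blocks no pair does), then
clause (X) of CKSU's simultaneous double product property holds — with NO mediator index left:
`a - a' + b - b' = 0` gives `a - b' = a' - b`, hence `‖a - b'‖² = ‖a' - b‖²`, hence (spheres)
`a ⬝ᵥ b' = a' ⬝ᵥ b = τ`, hence `(a, b')` is an in-block pair, `i = k`.
CKSU 2005 Prop. 4.5 is the ORTHANT instance (nonnegative vectors: `a ⬝ᵥ b = 0 ↔` disjoint supports; blocks =
support antichain), Beker 2024 (arXiv:2402.19169 §2) is the single-point instance (`uᵢ ⬝ᵥ uₖ - r = -‖uᵢ-uₖ‖²/2`).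

* `sdpp_X_of_sphericalBiclique` — the certificate (PROVED below, Mathlib only).
* `SphericalBicliqueDesigns` — the transfer target C⁺ (a STRONGER statement than the crux: designs in a box of
  `ℤ^D` certified spherically, with the crux's exponents); C⁺ → crux is the carry-free radix-`4m` Freiman transfer
  of the box into a Bertrand prime (as in route support CyclicReduction / `Theorems.exists_prime_sdpp_of_addEquiv`),
  not restated here.
-/

namespace Summit.MatrixMultiplication.MatrixMultiplication.Cruxes.PrimeTwoFamilies.IdeatorFour

open Finset Matrix

/-- **Spherical certificate for clause (X).**  Points of every `A i` on the sphere `a ⬝ᵥ a = ρ`, points of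
every `B i` on `b ⬝ᵥ b = σ`, in-block pairs at level `τ`, cross-block pairs never at level `τ` ⟹ clause (X):
`(a - a') + (b - b') = 0` with `a ∈ A i, a' ∈ A j, b ∈ B j, b' ∈ B k` forces `i = k`. -/
theorem sdpp_X_of_sphericalBiclique {D n : ℕ} (A B : Fin n → Finset (Fin D → ℤ)) (ρ σ τ : ℤ)
    (hA : ∀ i, ∀ a ∈ A i, a ⬝ᵥ a = ρ) (hB : ∀ i, ∀ b ∈ B i, b ⬝ᵥ b = σ)
    (hin : ∀ i, ∀ a ∈ A i, ∀ b ∈ B i, a ⬝ᵥ b = τ)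
    (hout : ∀ i k, i ≠ k → ∀ a ∈ A i, ∀ b ∈ B k, a ⬝ᵥ b ≠ τ) :
    ∀ i j k : Fin n, ∀ a ∈ A i, ∀ a' ∈ A j, ∀ b ∈ B j, ∀ b' ∈ B k,
      (a - a') + (b - b') = 0 → i = k := by
  intro i j k a ha a' ha' b hb b' hb' h
  by_contra hik
  have e : a - b' = a' - b := by
    have : a - a' + (b - b') = (a - b') - (a' - b) := by abel
    rw [this] at h
    exact sub_eq_zero.1 h
  have hsq : (a - b') ⬝ᵥ (a - b') = (a' - b) ⬝ᵥ (a' - b) := by rw [e]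
  simp only [sub_dotProduct, dotProduct_sub] at hsq
  have h1 := hA i a ha
  have h2 := hA j a' ha'
  have h3 := hB j b hb
  have h4 := hB k b' hb'
  have h5 := hin j a' ha' b hb
  have c1 : b' ⬝ᵥ a = a ⬝ᵥ b' := dotProduct_comm _ _
  have c2 : b ⬝ᵥ a' = a' ⬝ᵥ b := dotProduct_comm _ _
  have key : a ⬝ᵥ b' = τ := by linarith
  exact hout i k hik a ha b' hb' key

/-- The transfer target **C⁺ = SphericalBicliqueDesigns** (STRONGER than the crux; OPEN): for every `ε > 0` and
arbitrarily large `m` there are a dimension `D`, `n` pairs of finite sets of integer vectors with all coordinates in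
`[-m, m]`, certified spherically (concentric spheres `ρ, σ`, level `τ`, in-block level, cross-block non-level),
each pair direct, with the crux's exponents measured against the box: `n ≥ ((2m+1)^D)^{1/2-ε}` blocks of
co-volume `|A i| * |B i| ≥ ((2m+1)^D)^{1-ε}`, and `D * log 4 ≤ ε * D * log (2m+1)` (so that the radix-`4m`
transfer overhead `4^D` is `≤ N^ε`).  By `sdpp_X_of_sphericalBiclique` + directness these are SDPP families in
`ℤ^D`; the Freiman box transfer then yields every slice of `PrimeTwoFamilies`. -/
def SphericalBicliqueDesigns : Prop :=
  ∀ ε : ℝ, 0 < ε → ∀ m₀ : ℕ, ∃ m ≥ m₀, ∃ (D n : ℕ) (A B : Fin n → Finset (Fin D → ℤ)) (ρ σ τ : ℤ),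
    Real.log 4 ≤ ε * Real.log (2 * m + 1) ∧
    (∀ i, ∀ a ∈ A i, ∀ t, |a t| ≤ m) ∧ (∀ i, ∀ b ∈ B i, ∀ t, |b t| ≤ m) ∧
    (∀ i, ∀ a ∈ A i, a ⬝ᵥ a = ρ) ∧ (∀ i, ∀ b ∈ B i, b ⬝ᵥ b = σ) ∧
    (∀ i, ∀ a ∈ A i, ∀ b ∈ B i, a ⬝ᵥ b = τ) ∧
    (∀ i k, i ≠ k → ∀ a ∈ A i, ∀ b ∈ B k, a ⬝ᵥ b ≠ τ) ∧
    (∀ i, ∀ a ∈ A i, ∀ a' ∈ A i, ∀ b ∈ B i, ∀ b' ∈ B i, (a - a') + (b - b') = 0 → a = a' ∧ b = b') ∧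
    (((2 * m + 1 : ℝ) ^ D) ^ (1 / 2 - ε) ≤ (n : ℝ)) ∧
    (∀ i, (((2 * m + 1 : ℝ) ^ D) ^ (1 - ε)) ≤ (((A i).card * (B i).card : ℕ) : ℝ))

/-- Sanity instance of the certificate's hypotheses in dimension 2 (the "circle" case, where level-0 orthogonality
of lattice points on `x² + y² = 5` IS the block relation): blocks `({(1,2),(-1,-2)}, {(2,-1),(-2,1)})` and
`({(2,1),(-2,-1)}, {(1,-2),(-1,2)})`. Checked by `decide`. -/
example :
    let A : Fin 2 → Finset (Fin 2 → ℤ) := ![{![1, 2], ![-1, -2]}, {![2, 1], ![-2, -1]}]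
    let B : Fin 2 → Finset (Fin 2 → ℤ) := ![{![2, -1], ![-2, 1]}, {![1, -2], ![-1, 2]}]
    (∀ i, ∀ a ∈ A i, a ⬝ᵥ a = 5) ∧ (∀ i, ∀ b ∈ B i, b ⬝ᵥ b = 5) ∧
    (∀ i, ∀ a ∈ A i, ∀ b ∈ B i, a ⬝ᵥ b = 0) ∧
    (∀ i k, i ≠ k → ∀ a ∈ A i, ∀ b ∈ B k, a ⬝ᵥ b ≠ 0) := by
  decide

end Summit.MatrixMultiplication.MatrixMultiplication.Cruxes.PrimeTwoFamilies.IdeatorFour
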